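import Mathlib.LinearAlgebra.Matrix.GeneralLinearGroup.Defs
import Mathlib.Algebra.Group.ConjFinite
import Mathlib.FieldTheory.Finite.Basic
import Mathlib.RingTheory.AdjoinRoot
import Mathlib.LinearAlgebra.Matrix.Charpoly.Minpoly
import Mathlib.Algebra.GroupWithZero.Units.Fintype
import HarnessLib

/-!
# The class number of `GL_n(𝔽_q)`: `q^n − q^{n−1} ≤ k(GL(n, q)) ≤ q^n` (Fulman–Guralnick 2012,
# Prop. 3.5(2); upper bound due to Maslen–Rockmore) — named fact

Topic `Literature/RepresentationTheory/FiniteGroups`; cite item `wi-48974` (route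
`MatrixMultiplication/LevelGradedCohnUmans`; consumer
`Summits/…/SubgroupIdentityDesigns/Negative/TensorRankBridge.lean`, hypotheses `hcl`/`hclm` of
`linear_level_law` / `field_degree_law`), companion of `GLnTensorRankSpectrum.lean` (where the number
of irreducible characters of strict tensor rank `k` of `GL_n(F)` is `#Cl(GL_k(F))` in the stable range).

## Source

J. Fulman, R. Guralnick, *Bounds on the number and sizes of conjugacy classes in finite Chevalley
groups with applications to derangements*, Trans. Amer. Math. Soc. 364 (2012), 3023–3070
[FulmanGuralnick2012], §3, Proposition 3.5 (held copy p. 9, read): "(1) For `q` fixed,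
`lim_{n→∞} k(GL(n,q))/qⁿ = 1`.  (2) `qⁿ − q^{n−1} ≤ k(GL(n, q)) ≤ qⁿ`.  Thus
`lim_{q→∞} k(GL(n,q))/qⁿ = 1`, and the convergence is uniform in `n`."  Before it: "Using clever
reasoning and Euler's pentagonal number theorem, it is proved in [MR] (Maslen–Rockmore) that the
number of conjugacy classes of `GL(n, q)` is less than `qⁿ`."  Here `k(G)` is the number of
conjugacy classes and `n ≥ 1` (the generating function `∑_n k(GL(n,q)) tⁿ`).

## Rendering

`GL(n, q)` for a finite field `F` with `q = Fintype.card F` elements is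
`Matrix.GeneralLinearGroup (Fin n) F`; `k(G) = Nat.card (ConjClasses G)`; natural-number
arithmetic (`qⁿ − q^{n−1}` is an honest difference for `n ≥ 1`, `q ≥ 2`).  The fact is part (2) for
`n ≥ 1`, statement only; the degenerate `n = 0` (`GL(0, q)` trivial, one class) is PROVED here, so
the upper bound holds for all `n` (`….classNumber_GL_le`).  Part (1) and the limits are not vendored.
-/

namespace Literature.RepresentationTheory.FiniteGroups

/-- **Fulman–Guralnick 2012, Prop. 3.5(2)** (upper bound: Maslen–Rockmore): for a finite field `F`
with `q` elements and `n ≥ 1`, the number `k(GL(n, q))` of conjugacy classes of `GL_n(F)` satisfies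
`qⁿ − q^{n−1} ≤ k(GL(n, q)) ≤ qⁿ`.  Statement only; users take
`(h : FulmanGuralnick2012_prop35)`. [cite: FulmanGuralnick2012, Prop. 3.5(2)] -/
def FulmanGuralnick2012_prop35 : Prop :=
  ∀ (F : Type) [Field F] [Fintype F] (n : ℕ), 0 < n →
    Fintype.card F ^ n - Fintype.card F ^ (n - 1) ≤
        Nat.card (ConjClasses (Matrix.GeneralLinearGroup (Fin n) F)) ∧
      Nat.card (ConjClasses (Matrix.GeneralLinearGroup (Fin n) F)) ≤ Fintype.card F ^ n

/-- The degenerate case `n = 0`: `GL_0(F)` is the trivial group and has exactly one conjugacy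
class. [cite: FulmanGuralnick2012, §3 (generating function ∑ₙ k(GL(n,q)) tⁿ, constant term 1)] -/
theorem natCard_conjClasses_GL_fin_zero (F : Type) [Field F] :
    Nat.card (ConjClasses (Matrix.GeneralLinearGroup (Fin 0) F)) = 1 := by
  haveI : Subsingleton (Matrix (Fin 0) (Fin 0) F) := inferInstance
  haveI : Subsingleton (Matrix.GeneralLinearGroup (Fin 0) F) :=
    ⟨fun a b => Units.ext (Subsingleton.elim _ _)⟩
  haveI : Subsingleton (ConjClasses (Matrix.GeneralLinearGroup (Fin 0) F)) :=
    Quotient.instSubsingletonQuotient _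
  haveI : Unique (ConjClasses (Matrix.GeneralLinearGroup (Fin 0) F)) :=
    uniqueOfSubsingleton (ConjClasses.mk 1)
  exact Nat.card_unique

/-- **`k(GL(n, q)) ≤ qⁿ` for every `n`** (Maslen–Rockmore; Fulman–Guralnick Prop. 3.5(2)), the form
consumed by route `MatrixMultiplication/LevelGradedCohnUmans`: from the fact for `n ≥ 1` and the
proved trivial case `n = 0`. [cite: FulmanGuralnick2012, Prop. 3.5(2) (upper bound)] -/
theorem FulmanGuralnick2012_prop35.classNumber_GL_le (h : FulmanGuralnick2012_prop35)
    (F : Type) [Field F] [Fintype F] (n : ℕ) :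
    Nat.card (ConjClasses (Matrix.GeneralLinearGroup (Fin n) F)) ≤ Fintype.card F ^ n := by
  rcases Nat.eq_zero_or_pos n with rfl | hn
  · rw [natCard_conjClasses_GL_fin_zero, pow_zero]
  · exact (h F n hn).2

/-- **`qⁿ − q^{n−1} ≤ k(GL(n, q))` for `n ≥ 1`** (Fulman–Guralnick Prop. 3.5(2), lower bound).
[cite: FulmanGuralnick2012, Prop. 3.5(2) (lower bound)] -/
theorem FulmanGuralnick2012_prop35.classNumber_GL_ge (h : FulmanGuralnick2012_prop35)
    (F : Type) [Field F] [Fintype F] {n : ℕ} (hn : 0 < n) :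
    Fintype.card F ^ n - Fintype.card F ^ (n - 1) ≤
      Nat.card (ConjClasses (Matrix.GeneralLinearGroup (Fin n) F)) :=
  (h F n hn).1


/-! ## The lower bound `qⁿ − q^{n−1} ≤ k(GL(n, q))`, PROVED (companion matrices)

The lower half of Prop. 3.5(2) is elementary and is proved here unconditionally: the `qⁿ − q^{n−1}`
monic polynomials `f` of degree `n` with `f(0) ≠ 0` give pairwise non-conjugate elements of
`GL_n(F)` — the matrix of multiplication by `x̄` on `F[X]/(f)` (a companion matrix) has
characteristic polynomial `f` (Mathlib: `charpoly_leftMulMatrix` for `AdjoinRoot.powerBasis`,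
`AdjoinRoot.minpoly_powerBasis_gen_of_monic`), is invertible since `det = (−1)ⁿ f(0)`, and
conjugate matrices have the same characteristic polynomial.  This is the printed argument
(arXiv:0902.2238 = TAMS 364, proof of Prop. 3.5: "the lower bound holds since `GL(n,q)` has
`qⁿ − q^{n−1}` semisimple conjugacy classes, corresponding to the possible characteristic
polynomials"); the upper half `k(GL(n,q)) ≤ qⁿ` (Maslen–Rockmore, via the generating function
`∏_{i≥1} (1 − tⁱ)/(1 − q tⁱ)` and Euler's pentagonal number theorem) stays the content of the named
fact above. -/

section LowerBound

open Polynomial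

variable (F : Type) [Field F]

/-- `Xⁿ + ∑_{i<n} cᵢ Xⁱ` is monic of degree `n` with lower coefficients `cᵢ`. [folklore] -/
private theorem monic_poly_of_coeffs (n : ℕ) (c : Fin n → F) :
    (X ^ n + ∑ i : Fin n, C (c i) * X ^ (i : ℕ)).Monic ∧
      (X ^ n + ∑ i : Fin n, C (c i) * X ^ (i : ℕ)).natDegree = n ∧
      ∀ i : Fin n, (X ^ n + ∑ i : Fin n, C (c i) * X ^ (i : ℕ)).coeff i = c i := by
  refine ⟨monic_X_pow_add (degree_sum_fin_lt c), ?_, fun i => ?_⟩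
  · rw [natDegree_add_eq_left_of_degree_lt, natDegree_X_pow]
    rw [degree_X_pow]
    exact degree_sum_fin_lt c
  · rw [coeff_add, coeff_X_pow, if_neg (Nat.ne_of_lt i.isLt), zero_add, finsetSum_coeff]
    simp_rw [coeff_C_mul_X_pow]
    rw [Finset.sum_eq_single i]
    · simp
    · intro j _ hj
      rw [if_neg]
      exact fun h => hj (Fin.ext h.symm)
    · intro h
      exact absurd (Finset.mem_univ i) h

/-- Distinct coefficient vectors give distinct polynomials. [folklore] -/
private theorem poly_of_coeffs_injective (n : ℕ) :
    Function.Injective fun c : Fin n → F => X ^ n + ∑ i : Fin n, C (c i) * X ^ (i : ℕ) := by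
  intro c c' h
  funext i
  rw [← (monic_poly_of_coeffs F n c).2.2 i, ← (monic_poly_of_coeffs F n c').2.2 i]
  exact congrArg (fun f : F[X] => f.coeff i) h

/-- **Companion matrices**: every `Xⁿ + ∑_{i<n} cᵢ Xⁱ` is the characteristic polynomial of an
`n × n` matrix — multiplication by `x̄` on `F[X]/(f)` in the power basis (Mathlib's
`charpoly_leftMulMatrix` + `AdjoinRoot.minpoly_powerBasis_gen_of_monic`). [folklore] -/
private theorem exists_matrix_charpoly_eq (n : ℕ) (c : Fin n → F) :
    ∃ M : Matrix (Fin n) (Fin n) F, M.charpoly = X ^ n + ∑ i : Fin n, C (c i) * X ^ (i : ℕ) := by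
  obtain ⟨hmon, hdeg, -⟩ := monic_poly_of_coeffs F n c
  let pb := AdjoinRoot.powerBasis hmon.ne_zero
  have hdim : pb.dim = n := by rw [AdjoinRoot.powerBasis_dim, hdeg]
  refine ⟨Matrix.reindex (finCongr hdim) (finCongr hdim) (Algebra.leftMulMatrix pb.basis pb.gen), ?_⟩
  rw [Matrix.charpoly_reindex, charpoly_leftMulMatrix,
    AdjoinRoot.minpoly_powerBasis_gen_of_monic hmon]

/-- **Fulman–Guralnick 2012, Prop. 3.5(2), lower bound — PROVED: `qⁿ − q^{n−1} ≤ k(GL(n, q))`**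
for every finite field `F` with `q` elements and every `n ≥ 1` — the printed proof: "`GL(n,q)` has
`qⁿ − q^{n−1}` semisimple conjugacy classes, corresponding to the possible characteristic
polynomials" (here: companion matrices of the monic `f` of degree `n` with `f(0) ≠ 0` are invertible,
`det = (−1)ⁿ f(0)`, and pairwise non-conjugate since conjugate matrices have the same characteristic
polynomial).  Unconditional form of `FulmanGuralnick2012_prop35.classNumber_GL_ge`; the named fact
keeps the (harder) upper bound. [cite: FulmanGuralnick2012, Prop. 3.5(2) (lower bound) and its proof] -/
theorem FulmanGuralnick2012_prop35_lower (F : Type) [Field F] [Fintype F] {n : ℕ} (hn : 0 < n) :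
    Fintype.card F ^ n - Fintype.card F ^ (n - 1) ≤
      Nat.card (ConjClasses (Matrix.GeneralLinearGroup (Fin n) F)) := by
  classical
  obtain ⟨k, rfl⟩ : ∃ k, n = k + 1 := ⟨n - 1, by omega⟩
  -- companion matrices `M c` with `charpoly (M c) = X^{k+1} + ∑ cᵢ Xⁱ`
  choose M hM using exists_matrix_charpoly_eq F (k + 1)
  -- for `c = (u, v)` with `u ∈ Fˣ` the constant coefficient is `u ≠ 0`, so `M` is invertible
  have hdet : ∀ p : Fˣ × (Fin k → F), (M (Fin.cons (p.1 : F) p.2)).det ≠ 0 := by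
    intro p
    rw [Matrix.det_eq_sign_charpoly_coeff, hM,
      (monic_poly_of_coeffs F (k + 1) _).2.2 ⟨0, Nat.succ_pos k⟩]
    exact mul_ne_zero (pow_ne_zero _ (neg_ne_zero.mpr one_ne_zero)) (by simp)
  let Φ : Fˣ × (Fin k → F) → ConjClasses (Matrix.GeneralLinearGroup (Fin (k + 1)) F) := fun p =>
    ConjClasses.mk (Matrix.GeneralLinearGroup.mkOfDetNeZero _ (hdet p))
  have hΦ : Function.Injective Φ := by
    intro p p' h
    simp only [Φ] at h
    rw [ConjClasses.mk_eq_mk_iff_isConj, isConj_iff] at h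
    obtain ⟨g, hg⟩ := h
    have hmat := congrArg (fun x : Matrix.GeneralLinearGroup (Fin (k + 1)) F =>
      (x : Matrix (Fin (k + 1)) (Fin (k + 1)) F).charpoly) hg
    simp only [Units.val_mul, Matrix.coe_units_inv, Matrix.charpoly_units_conj,
      Matrix.GeneralLinearGroup.val_mkOfDetNeZero, hM] at hmat
    have hc := poly_of_coeffs_injective F (k + 1) hmat
    obtain ⟨u, v⟩ := p
    obtain ⟨u', v'⟩ := p'
    simp only at hc
    rw [Fin.cons_inj] at hc
    exact Prod.ext (Units.ext hc.1) hc.2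
  have hcard : Nat.card (Fˣ × (Fin k → F)) = Fintype.card F ^ (k + 1) - Fintype.card F ^ k := by
    rw [Nat.card_prod, Nat.card_units, Nat.card_fun, Nat.card_eq_fintype_card,
      Nat.card_eq_fintype_card, Fintype.card_fin, Nat.sub_mul, one_mul, pow_succ']
  rw [Nat.add_sub_cancel, ← hcard]
  exact Nat.card_le_card_of_injective Φ hΦ

end LowerBound

end Literature.RepresentationTheory.FiniteGroups
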